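import Literature.NumberTheory.LFunctions.LFDSingleDensity
import Literature.NumberTheory.LFunctions.DHPositivity
import Literature.NumberTheory.LFunctions.GranvilleMollinLinnikFromDHDensity
import HarnessLib

/-!
# The low-height zero-density estimate with the Deuring–Heilbronn factor, moderate range

Topic `Literature/NumberTheory/LFunctions`, namespace `SiegelZero`. THEOREMS only.

The hypothesis "Theorem J" of `SiegelZero.GranvilleMollin2000_eq33_of_dhDensity`
(`GranvilleMollinLinnikFromDHDensity.lean`) is a log-free zero-density estimate for one primitive
quadratic character `χ` mod `q` at low height, with the Deuring–Heilbronn factor `(1 − β₁) log q`: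
`N(α, q^{θ₁}; χ, {β₁}) ≤ K_J ((1 − β₁) log q) q^{a(1−α)}` (`a < 9`). This file proves it in the
range `C_r/(log q)⁵ ≤ (1 − β₁) log q ≤ c_l` (with `θ₁ = 1/1000`, `a = 7`), assembling three inputs of
the tree:

* Heath-Brown's single-character log-free density estimate (Lemma 11.1 with scale-averaged weights,
  `LFDSingle.logFreeDensity_single`): `N(1 − λ/L, q^{1/1000}; χ) ≤ K e^{3λ}` for `λ ≤ L/1000`
  (`L = log q`);
* the Deuring–Heilbronn phenomenon by positivity in the moderate range
  (`DHTest.deuringHeilbronn_moderate`, Heath-Brown Lemma 8.1): every zero `ρ ≠ β₁` with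
  `Re ρ ≥ 1/2`, `|Im ρ| ≤ q^{1/100}` has `(1 − Re ρ)L ≥ (1/4) log(1/λ₁) − c₀`, `λ₁ = (1 − β₁)L`;
* the trivial count `N(T, χ) ≪ T log q` for `T ≤ q` (`SiegelZero.exists_boxCount_le_of_le`).

If a zero `ρ ≠ β₁` with `Re ρ ≥ α = 1 − λ/L` exists then `λ ≥ (1/4) log(1/λ₁) − c₀`, so
`K e^{3λ} = K e^{7λ} e^{−4λ} ≤ K e^{4c₀} λ₁ e^{7λ} = K e^{4c₀} λ₁ q^{7(1−α)}`; for `λ > L/1000` the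
trivial count `≪ q^{1/1000} L` is `≤ K λ₁ q^{7/1000}` because `λ₁ ≥ C_r L^{−5}`. The complementary
range `(1 − β₁) log q < C_r/(log q)⁵` (very good Siegel zeros) is NOT covered here: it needs the
zero-density estimate twisted by the pseudo-character `1 ∗ χ` of Motohashi, Proc. Japan Acad. 53A
(1977) 25–27 (part II), in the tree as the named fact `motohashi1977_theoremII`
(`TwistedLogFreeDensityMotohashi.lean`), which supplies exactly this range through
`SiegelZero.theoremJ_of_motohashi` (`TheoremJFromMotohashi.lean`). (ERRATUM 2026-08-27, cell
`landau-siegel` §C r3, read on the page images of Math. Scand. 41: an earlier version of this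
sentence cited "Jutila, Math. Scand. 41 (1977), Theorem 2" for the twisted density — Jutila's
Theorem 2 (p. 47, (1.10)) is the Deuring–Heilbronn REPULSION theorem
`δ₁ ≥ (1 − 6δ) D^{−(2+ε)δ/(1−6δ)}/(8 log D)`, `D = q(|τ|+1) ≥ D₀(ε)`, proved via the pseudo-characters
`f(n) = μ(n)2^{−ω(n)}n`; it is not a density estimate. His Theorem 1 is the plain log-free density
`N(α,T,q) ≪_ε (qT)^{(2+ε)(1−α)}`, `4/5 ≤ α ≤ 1`, `T ≥ 1`.)

## References

* D. R. Heath-Brown, *Zero-free regions for Dirichlet L-functions, and the least prime in an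
  arithmetic progression*, PLMS (3) 64 (1992), Lemma 8.1, Lemma 11.1. [HeathBrown1992PLMS]
* M. Jutila, *On Linnik's constant*, Math. Scand. 41 (1977) 45–62, Theorems 1–2 (context: the
  repulsion and plain-density records of 1977; not used in this file). [Jutila1977Linnik]
* Y. Motohashi, *On the Deuring–Heilbronn phenomenon. II*, Proc. Japan Acad. 53A (1977) 25–27
  (the twisted density covering the complementary range; tree: `motohashi1977_theoremII`).
-/

noncomputable section

open Finset Real Complex

namespace Literature.NumberTheory.LFunctions

namespace SiegelZero

open Literature.NumberTheory.LFunctions.DirichletZFR DirichletCharacter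

/-- **Theorem J in the moderate range** `C_r/(log q)⁵ ≤ (1 − β₁) log q ≤ c_l`: there are absolute
`C_r, c_l > 0`, `K_J ≥ 0`, `q_J` such that for every primitive quadratic `χ` mod `q ≥ q_J`, every real
zero `β₁` of `L(s, χ)` with `C_r/(log q)⁵ ≤ (1 − β₁) log q ≤ c_l` and every `1/2 ≤ α ≤ 1`,
`N(α, q^{1/1000}; χ, {β₁}) ≤ K_J ((1 − β₁) log q) q^{7(1−α)}`
(`Literature.NumberTheory.LFunctions.charZeroCount`, multiplicities, `β₁` excluded).
[cite: HeathBrown1992PLMS, Lemma 8.1 and Lemma 11.1] -/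
theorem dhDensity_moderate :
    ∃ C_r c_l KJ qJ : ℝ, 0 < C_r ∧ 0 < c_l ∧ 0 ≤ KJ ∧
      ∀ (q : ℕ) [NeZero q] (χ : DirichletCharacter ℂ q), χ.IsPrimitive → χ.IsQuadratic →
        qJ ≤ (q : ℝ) → ∀ β₁ : ℝ, χ.LFunction β₁ = 0 →
          C_r / Real.log q ^ 5 ≤ (1 - β₁) * Real.log q → (1 - β₁) * Real.log q ≤ c_l →
          ∀ α : ℝ, 1 / 2 ≤ α → α ≤ 1 →
            charZeroCount χ α ((q : ℝ) ^ (1 / 1000 : ℝ)) {(β₁ : ℂ)} ≤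
              KJ * ((1 - β₁) * Real.log q) * (q : ℝ) ^ (7 * (1 - α)) := by
  classical
  obtain ⟨K, q₀, hK, hA⟩ := LFDSingle.logFreeDensity_single
  obtain ⟨C_r, c_l, L₀, hC_r, hc_l, hL₀, hB⟩ := DHTest.deuringHeilbronn_moderate
  obtain ⟨c₄, hc₄, hsimple⟩ := exists_deriv_ne_zero_of_realZero
  obtain ⟨Cw, hCw, hbox⟩ := exists_boxCount_le_of_le
  -- constants
  obtain ⟨c₀, hc₀⟩ : ∃ c₀ : ℝ, c₀ = Real.log 400 / 4 + 1 := ⟨_, rfl⟩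
  obtain ⟨c_l', hc_l'⟩ : ∃ c : ℝ, c = min c_l (min (c₄ / 2) (1 / 2)) := ⟨_, rfl⟩
  have hc_l'0 : 0 < c_l' := by rw [hc_l']; exact lt_min hc_l (lt_min (by positivity) (by norm_num))
  have hc_l'le : c_l' ≤ c_l := by rw [hc_l']; exact min_le_left _ _
  have hc_l'c₄ : c_l' ≤ c₄ / 2 := by rw [hc_l']; exact (min_le_right _ _).trans (min_le_left _ _)
  obtain ⟨KJ, hKJ⟩ : ∃ KJ : ℝ, KJ = K * Real.exp (4 * c₀) + 1 := ⟨_, rfl⟩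
  have hKJ0 : 0 ≤ KJ := by rw [hKJ]; positivity
  have hKJ1 : 1 ≤ KJ := by rw [hKJ]; exact le_add_of_nonneg_left (by positivity)
  have hKKJ : K * Real.exp (4 * c₀) ≤ KJ := by rw [hKJ]; linarith
  -- threshold in `L = log q`
  obtain ⟨t₁, -, ht₁⟩ := exists_mul_pow_le_exp (Cw / C_r) 6 (6 / 1000) (by norm_num)
  obtain ⟨Lth, hLth⟩ : ∃ Lth : ℝ, Lth = max (max L₀ t₁) 2000 := ⟨_, rfl⟩
  refine ⟨C_r, c_l', KJ, max (Real.exp Lth) q₀, hC_r, hc_l'0, hKJ0, ?_⟩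
  intro q _ χ hprim hquad hq β₁ hβ₁ hlo hhi α hα hα1
  /- sizes -/
  have hqexp : Real.exp Lth ≤ q := (le_max_left _ _).trans hq
  have hq₀ : q₀ ≤ (q : ℝ) := (le_max_right _ _).trans hq
  have h2000 : (2000 : ℝ) ≤ Lth := by rw [hLth]; exact le_max_right _ _
  have hq7 : (7 : ℝ) ≤ q := by
    have h1 : (7 : ℝ) ≤ Real.exp Lth := by
      have := Real.add_one_le_exp Lth; linarith
    exact h1.trans hqexp
  have hq0 : (0 : ℝ) < q := by linarith
  have hq1 : (1 : ℝ) < q := by linarith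
  have hq1n : 1 < q := by exact_mod_cast hq1
  obtain ⟨L, hLdef⟩ : ∃ L : ℝ, L = Real.log q := ⟨_, rfl⟩
  have hLth' : Lth ≤ L := by
    rw [hLdef, ← Real.log_exp Lth]; exact Real.log_le_log (Real.exp_pos _) hqexp
  rw [hLth] at hLth'
  have hLL₀ : L₀ ≤ L := ((le_max_left _ _).trans (le_max_left _ _)).trans hLth'
  have hLt₁ : t₁ ≤ L := ((le_max_right _ _).trans (le_max_left _ _)).trans hLth'
  have hL2000 : 2000 ≤ L := (le_max_right _ _).trans hLth'
  have hL0 : 0 < L := by linarith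
  have hχ1 : χ ≠ 1 := by
    intro h
    have : χ.conductor = 1 := by rw [h, DirichletCharacter.conductor_one]
    rw [hprim] at this
    omega
  rw [← hLdef] at hlo hhi
  obtain ⟨lam1, hlam1⟩ : ∃ l : ℝ, l = (1 - β₁) * L := ⟨_, rfl⟩
  rw [← hlam1] at hlo hhi
  have hlam1pos : 0 < lam1 := lt_of_lt_of_le (by positivity) hlo
  have h1β₁ : 0 < 1 - β₁ := by
    by_contra hcon; push Not at hcon
    have : lam1 ≤ 0 := by rw [hlam1]; exact mul_nonpos_of_nonpos_of_nonneg hcon hL0.le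
    linarith
  -- simplicity of `β₁`
  have hβ₁near : 1 - c₄ / (Real.log q + Real.log 4) < β₁ := by
    have hl4 : Real.log 4 < L := by
      have : Real.log 4 ≤ 4 := by
        have := Real.log_le_sub_one_of_pos (show (0:ℝ) < 4 by norm_num); linarith
      linarith
    have hl40 : 0 < Real.log 4 := Real.log_pos (by norm_num)
    have h1 : 1 - β₁ ≤ c₄ / 2 / L := by
      rw [le_div_iff₀ hL0, ← hlam1]; exact hhi.trans hc_l'c₄
    have h2 : c₄ / 2 / L < c₄ / (Real.log q + Real.log 4) := by
      rw [← hLdef, div_div, div_lt_div_iff_of_pos_left hc₄ (by positivity) (by positivity)]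
      linarith
    linarith
  have hmβ₁ : DirichletDisc.zeroOrder χ β₁ = 1 :=
    zeroOrder_eq_one_of_deriv_ne_zero hχ1 hβ₁ (hsimple q χ hχ1 β₁ hβ₁ hβ₁near)
  /- the count -/
  obtain ⟨T, hT⟩ : ∃ T : ℝ, T = (q : ℝ) ^ (1 / 1000 : ℝ) := ⟨_, rfl⟩
  have hTexp : T = Real.exp (L / 1000) := by
    rw [hT, Real.rpow_def_of_pos hq0, hLdef]; ring_nf
  have hT6 : 6 ≤ T := by
    rw [hTexp]
    exact six_le_exp_two.trans (Real.exp_le_exp.2 (by linarith))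
  have hTq : T ≤ q := by
    rw [hT]
    calc (q : ℝ) ^ (1 / 1000 : ℝ) ≤ (q : ℝ) ^ (1 : ℝ) :=
          Real.rpow_le_rpow_of_exponent_le hq1.le (by norm_num)
      _ = q := Real.rpow_one _
  have hTe : T ≤ Real.exp (Real.log q / 100) := by
    rw [hTexp, ← hLdef]; exact Real.exp_le_exp.2 (by linarith)
  rw [← hT]
  set F := ((lfunctionZeroBox_finite hχ1 T).toFinset \ {(β₁ : ℂ)}).filter (fun ρ => α ≤ ρ.re)
    with hF
  have hcount : charZeroCount χ α T {(β₁ : ℂ)} = ∑ ρ ∈ F, (DirichletDisc.zeroOrder χ ρ : ℝ) := by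
    rw [charZeroCount_eq hχ1]
  have hmemF : ∀ ρ ∈ F, ρ ∈ lfunctionZeroBox χ T ∧ ρ ≠ (β₁ : ℂ) ∧ α ≤ ρ.re := by
    intro ρ hρ
    rw [hF, Finset.mem_filter, Finset.mem_sdiff, Set.Finite.mem_toFinset, Finset.mem_singleton] at hρ
    exact ⟨hρ.1.1, hρ.1.2, hρ.2⟩
  rw [hcount]
  -- `λ = (1 - α) L`
  obtain ⟨lam, hlam⟩ : ∃ l : ℝ, l = (1 - α) * L := ⟨_, rfl⟩
  have hlam0 : 0 ≤ lam := by rw [hlam]; exact mul_nonneg (by linarith) hL0.le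
  have hqpow : (q : ℝ) ^ (7 * (1 - α)) = Real.exp (7 * lam) := by
    rw [Real.rpow_def_of_pos hq0, ← hLdef, hlam]; ring_nf
  rw [hqpow, show (1 - β₁) * Real.log q = lam1 by rw [hlam1, hLdef]]
  rcases le_or_gt lam (L / 1000) with hsmall | hbig
  · /- Case `λ ≤ L/1000`: Thm A and DH -/
    have hZ : ∀ ρ ∈ F, χ.LFunction ρ = 0 ∧ 1 - lam / Real.log q ≤ ρ.re ∧
        |ρ.im| ≤ (q : ℝ) ^ (1 / 1000 : ℝ) := by
      intro ρ hρ
      obtain ⟨hbox', -, hre⟩ := hmemF ρ hρ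
      obtain ⟨h0, -, -, him⟩ := (mem_lfunctionZeroBox).1 hbox'
      refine ⟨h0, ?_, by rw [← hT]; exact him⟩
      rw [← hLdef, hlam]
      have : (1 - α) * L / L = 1 - α := by field_simp
      rw [this]; linarith
    have hAbound := hA q χ hprim hq₀ lam hlam0 (by rw [← hLdef]; exact hsmall) F hZ
    rcases F.eq_empty_or_nonempty with hFe | hFne
    · rw [hFe, Finset.sum_empty]; positivity
    · obtain ⟨ρ, hρ⟩ := hFne
      obtain ⟨hbox', hne, hre⟩ := hmemF ρ hρ
      obtain ⟨h0, hre0, hre1, him⟩ := (mem_lfunctionZeroBox).1 hbox'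
      -- DH: `(1/4) log(1/λ₁) - c₀ ≤ (1 - Re ρ) L ≤ λ`
      have hlo' : C_r / Real.log q ^ 5 ≤ (1 - β₁) * Real.log q := by
        rw [← hLdef, ← hlam1]; exact hlo
      have hhi' : (1 - β₁) * Real.log q ≤ c_l := by
        rw [← hLdef, ← hlam1]; exact hhi.trans hc_l'le
      have hDH := hB q χ hprim hquad (by rw [← hLdef]; exact hLL₀) β₁ hβ₁ hmβ₁ hlo' hhi' ρ
        (Or.inr h0) hne (by linarith) (him.trans hTe)
      rw [← hLdef, ← hlam1, ← hc₀] at hDH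
      have hρlam : (1 - ρ.re) * L ≤ lam := by
        rw [hlam]; exact mul_le_mul_of_nonneg_right (by linarith) hL0.le
      have hkey : 1 / 4 * Real.log (1 / lam1) - c₀ ≤ lam := hDH.trans hρlam
      -- `e^{3λ} ≤ e^{4c₀} λ₁ e^{7λ}`
      have hexp : Real.exp (3 * lam) ≤ Real.exp (4 * c₀) * lam1 * Real.exp (7 * lam) := by
        have h1 : Real.log (1 / lam1) ≤ 4 * lam + 4 * c₀ := by linarith
        have h2 : 1 / lam1 ≤ Real.exp (4 * lam + 4 * c₀) := by
          rw [← Real.exp_log (show 0 < 1 / lam1 by positivity)]; exact Real.exp_le_exp.2 h1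
        have h3 : 1 ≤ lam1 * Real.exp (4 * lam + 4 * c₀) := by
          rw [div_le_iff₀ hlam1pos] at h2; linarith
        have h4 : Real.exp (3 * lam) * (lam1 * Real.exp (4 * lam + 4 * c₀)) =
            Real.exp (4 * c₀) * lam1 * Real.exp (7 * lam) := by
          have e1 : Real.exp (4 * lam + 4 * c₀) = Real.exp (4 * lam) * Real.exp (4 * c₀) :=
            Real.exp_add _ _
          have e2 : Real.exp (3 * lam) * Real.exp (4 * lam) = Real.exp (7 * lam) := by
            rw [← Real.exp_add]; ring_nf
          rw [e1, ← e2]; ring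
        calc Real.exp (3 * lam) = Real.exp (3 * lam) * 1 := (mul_one _).symm
          _ ≤ Real.exp (3 * lam) * (lam1 * Real.exp (4 * lam + 4 * c₀)) :=
              mul_le_mul_of_nonneg_left h3 (Real.exp_pos _).le
          _ = Real.exp (4 * c₀) * lam1 * Real.exp (7 * lam) := h4
      have hpos : 0 ≤ lam1 * Real.exp (7 * lam) := by positivity
      calc ∑ ρ ∈ F, (DirichletDisc.zeroOrder χ ρ : ℝ) ≤ K * Real.exp (3 * lam) := hAbound
        _ ≤ K * (Real.exp (4 * c₀) * lam1 * Real.exp (7 * lam)) :=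
            mul_le_mul_of_nonneg_left hexp hK.le
        _ = (K * Real.exp (4 * c₀)) * (lam1 * Real.exp (7 * lam)) := by ring
        _ ≤ KJ * (lam1 * Real.exp (7 * lam)) := mul_le_mul_of_nonneg_right hKKJ hpos
        _ = KJ * lam1 * Real.exp (7 * lam) := by ring
  · /- Case `λ > L/1000`: the trivial count -/
    have htot := hbox q χ hprim hq1n T hT6 hTq F (fun ρ hρ => (hmemF ρ hρ).1)
    rw [← hLdef] at htot
    have h7 : Real.exp (7 * (L / 1000)) ≤ Real.exp (7 * lam) := Real.exp_le_exp.2 (by linarith)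
    have hthr : Cw / C_r * L ^ 6 ≤ Real.exp (6 / 1000 * L) := ht₁ L hLt₁
    have hL5 : 0 < L ^ 5 := by positivity
    have h1 : Cw * T * L * L ^ 5 ≤ C_r * Real.exp (7 * (L / 1000)) := by
      rw [hTexp]
      have h2 : Cw * L ^ 6 ≤ C_r * Real.exp (6 / 1000 * L) := by
        have := mul_le_mul_of_nonneg_left hthr hC_r.le
        rwa [← mul_assoc, mul_div_cancel₀ _ hC_r.ne'] at this
      have h3 : Real.exp (L / 1000) * Real.exp (6 / 1000 * L) = Real.exp (7 * (L / 1000)) := by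
        rw [← Real.exp_add]; ring_nf
      calc Cw * Real.exp (L / 1000) * L * L ^ 5 = Real.exp (L / 1000) * (Cw * L ^ 6) := by ring
        _ ≤ Real.exp (L / 1000) * (C_r * Real.exp (6 / 1000 * L)) :=
            mul_le_mul_of_nonneg_left h2 (Real.exp_pos _).le
        _ = C_r * Real.exp (7 * (L / 1000)) := by rw [← h3]; ring
    have h4 : C_r ≤ lam1 * L ^ 5 := (div_le_iff₀ hL5).1 hlo
    have h5 : Cw * T * L * L ^ 5 ≤ (lam1 * Real.exp (7 * lam)) * L ^ 5 := by
      calc Cw * T * L * L ^ 5 ≤ C_r * Real.exp (7 * (L / 1000)) := h1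
        _ ≤ (lam1 * L ^ 5) * Real.exp (7 * lam) :=
            mul_le_mul h4 h7 (Real.exp_pos _).le (by positivity)
        _ = (lam1 * Real.exp (7 * lam)) * L ^ 5 := by ring
    have h6 : Cw * T * L ≤ lam1 * Real.exp (7 * lam) := le_of_mul_le_mul_right h5 hL5
    have hpos : 0 ≤ lam1 * Real.exp (7 * lam) := by positivity
    calc ∑ ρ ∈ F, (DirichletDisc.zeroOrder χ ρ : ℝ) ≤ Cw * T * L := htot
      _ ≤ lam1 * Real.exp (7 * lam) := h6
      _ = 1 * (lam1 * Real.exp (7 * lam)) := (one_mul _).symm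
      _ ≤ KJ * (lam1 * Real.exp (7 * lam)) := mul_le_mul_of_nonneg_right hKJ1 hpos
      _ = KJ * lam1 * Real.exp (7 * lam) := by ring

end SiegelZero

end Literature.NumberTheory.LFunctions
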